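import Literature.Analysis.FluidPDE.NSBootstrapSlices
import Literature.Analysis.FluidPDE.NSBoundedTimeHolderTopQuant
import HarnessLib

/-!
# The Serrin bootstrap: the continuous representative

Analysis/FluidPDE proofs file (theorems only). A bounded distributional Navier–Stokes solution on
`Q(0, R)` with `∫∫ |p|^{3/2} ≤ P` has a representative `V` continuous on the open cylinder,
bounded by `|M|`, and Hölder continuous on every `Q(0, r₁)`, `r₁ < R`, with constants fixed
before the solution (`exists_continuous_rep`): the Lipschitz slices of
`NSBootstrap.ae_smooth_slices` feed the quantitative joint-Hölder representative of
`SliceTimeHolderQuant.exists_holderOnWith_representative_quant` (Robinson–Rodrigo–Sadowski 2016,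
Thm. 13.7 with Prop. 13.10; Seregin–Šverák 2009, §2 p. 8) on small centred cylinders adapted to
each pair of nearby points (`exists_local_holder_pairs`); local representatives agree on overlaps
(continuous and a.e. equal, `eqOn_of_ae_eq_of_continuousOn`), so they glue.

## References

* G. Seregin, V. Šverák, Comm. PDE 34 (2009) = arXiv:0804.1803, §2 p. 8. [`SereginSverak2009`]
* J. C. Robinson, J. L. Rodrigo, W. Sadowski, *The Three-Dimensional Navier–Stokes Equations*
  (2016), Thm. 13.7, Prop. 13.10. [`RobinsonRodrigoSadowskiCUP2016`]
-/

noncomputable section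

open MeasureTheory Set Function Filter Topology TopologicalSpace Metric
open scoped NNReal ENNReal RealInnerProductSpace ContDiff

namespace Literature.Analysis.FluidPDE

namespace NSBootstrap

open RepDeriv SliceTimeHolder SliceTimeHolderQuant

/-! ### Continuous functions agreeing a.e. on an open set agree there -/

/-- Two functions continuous on an open set and a.e. equal there (for a measure charging open
sets) are equal there. [folklore] -/
theorem eqOn_of_ae_eq_of_continuousOn {X Y : Type*} [TopologicalSpace X] [MeasurableSpace X] [OpensMeasurableSpace X]
    {μ : Measure X} [μ.IsOpenPosMeasure] [NormedAddCommGroup Y]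
    {O : Set X} (hO : IsOpen O) {f g : X → Y} (hf : ContinuousOn f O) (hg : ContinuousOn g O)
    (hae : f =ᵐ[μ.restrict O] g) : EqOn f g O := by
  intro w hw
  by_contra hne
  have hpos : 0 < ‖f w - g w‖ := norm_pos_iff.2 (sub_ne_zero.2 hne)
  have hc : ContinuousOn (fun z => ‖f z - g z‖) O := (hf.sub hg).norm
  set N : Set X := O ∩ (fun z => ‖f z - g z‖) ⁻¹' Ioi (‖f w - g w‖ / 2) with hN
  have hNopen : IsOpen N := hc.isOpen_inter_preimage hO isOpen_Ioi
  have hwN : w ∈ N := ⟨hw, by simp only [mem_preimage, mem_Ioi]; linarith⟩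
  have hNpos : 0 < μ N := hNopen.measure_pos μ ⟨w, hwN⟩
  have hNzero : μ N = 0 := by
    have h1 : ∀ᵐ z ∂μ, z ∈ O → f z = g z := (ae_restrict_iff' hO.measurableSet).1 hae
    have h0 := ae_iff.1 h1
    refine measure_mono_null (fun z hzN => ?_) h0
    intro hz
    have := hz hzN.1
    have h2 : ‖f w - g w‖ / 2 < ‖f z - g z‖ := hzN.2
    rw [this, sub_self, norm_zero] at h2
    linarith
  exact hNpos.ne' hNzero

/-- A function continuous on an open set and a.e. bounded there is bounded there. [folklore] -/
theorem norm_le_of_ae_of_continuousOn {X Y : Type*} [TopologicalSpace X] [MeasurableSpace X] [OpensMeasurableSpace X]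
    {μ : Measure X} [μ.IsOpenPosMeasure] [NormedAddCommGroup Y]
    {O : Set X} (hO : IsOpen O) {f : X → Y} (hf : ContinuousOn f O) {M : ℝ}
    (hae : ∀ᵐ z ∂(μ.restrict O), ‖f z‖ ≤ M) : ∀ w ∈ O, ‖f w‖ ≤ M := by
  intro w hw
  by_contra hlt
  rw [not_le] at hlt
  set N : Set X := O ∩ (fun z => ‖f z‖) ⁻¹' Ioi M with hN
  have hNopen : IsOpen N := hf.norm.isOpen_inter_preimage hO isOpen_Ioi
  have hNpos : 0 < μ N := hNopen.measure_pos μ ⟨w, hw, hlt⟩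
  have hNzero : μ N = 0 := by
    have h1 : ∀ᵐ z ∂μ, z ∈ O → ‖f z‖ ≤ M := (ae_restrict_iff' hO.measurableSet).1 hae
    refine measure_mono_null (fun z hzN => ?_) (ae_iff.1 h1)
    intro hz
    exact (hz hzN.1).not_gt hzN.2
  exact hNpos.ne' hNzero

/-! ### Vector fields from Lipschitz components -/

/-- A field whose components are `L`-Lipschitz is `3L`-Lipschitz. [folklore] -/
theorem norm_toLp_sub_toLp_le {S : Set (EuclideanSpace ℝ (Fin 3))} {vb : Fin 3 → EuclideanSpace ℝ (Fin 3) → ℝ} {L : ℝ}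
    (h : ∀ b, ∀ x ∈ S, ∀ y ∈ S, ‖vb b x - vb b y‖ ≤ L * ‖x - y‖) {x y : EuclideanSpace ℝ (Fin 3)}
    (hx : x ∈ S) (hy : y ∈ S) :
    ‖(WithLp.toLp 2 (fun b => vb b x) : EuclideanSpace ℝ (Fin 3)) - WithLp.toLp 2 (fun b => vb b y)‖ ≤ 3 * L * ‖x - y‖ := by
  rw [← WithLp.toLp_sub]
  refine (norm_toLp_le_sum_abs _).trans ?_
  calc ∑ b, |(fun b => vb b x) b - (fun b => vb b y) b| = ∑ b, ‖vb b x - vb b y‖ := by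
        simp [Real.norm_eq_abs]
    _ ≤ ∑ _b : Fin 3, L * ‖x - y‖ := Finset.sum_le_sum fun b _ => h b x hx y hy
    _ = 3 * L * ‖x - y‖ := by rw [Finset.sum_const, Finset.card_univ, Fintype.card_fin]; ring

/-! ### The pieces -/

/-- **Centred pieces adapted to a pair of nearby times.** For times `s, s' ∈ ]-r₁², 0[` with
`|s - s'| < ϱ²` and `2ϱ² ≤ ρ₁² - r₁²` there is a centre `τ` with
`]τ - ϱ², τ + ϱ²[ ⊆ ]-ρ₁², 0]` containing both. [folklore] -/
theorem exists_piece {r₁ ρ₁ ϱ : ℝ} (hϱ0 : 0 < ϱ) (h2 : 2 * ϱ ^ 2 ≤ ρ₁ ^ 2 - r₁ ^ 2) {s s' : ℝ}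
    (hs : s ∈ Ioo (-r₁ ^ 2) 0) (hs' : s' ∈ Ioo (-r₁ ^ 2) 0) (hss' : |s - s'| < ϱ ^ 2) :
    ∃ τ : ℝ, τ + ϱ ^ 2 ≤ 0 ∧ -ρ₁ ^ 2 ≤ τ - ϱ ^ 2 ∧ s ∈ Ioo (τ - ϱ ^ 2) (τ + ϱ ^ 2) ∧
      s' ∈ Ioo (τ - ϱ ^ 2) (τ + ϱ ^ 2) := by
  have hϱ2 : 0 < ϱ ^ 2 := by positivity
  rw [abs_lt] at hss'
  by_cases hc : max s s' < -ϱ ^ 2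
  · refine ⟨max s s', by linarith, ?_, ?_, ?_⟩
    · have : -r₁ ^ 2 < max s s' := lt_max_of_lt_left hs.1
      nlinarith
    · rcases le_total s s' with h | h
      · rw [max_eq_right h]; exact ⟨by linarith, by linarith⟩
      · rw [max_eq_left h]; exact ⟨by linarith, by linarith⟩
    · rcases le_total s s' with h | h
      · rw [max_eq_right h]; exact ⟨by linarith, by linarith⟩
      · rw [max_eq_left h]; exact ⟨by linarith, by linarith⟩
  · rw [not_lt] at hc
    refine ⟨-ϱ ^ 2, by linarith, by nlinarith [hs.1], ⟨?_, ?_⟩, ⟨?_, ?_⟩⟩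
    · rcases le_total s s' with h | h
      · rw [max_eq_right h] at hc; linarith
      · rw [max_eq_left h] at hc; linarith
    · linarith [hs.2]
    · rcases le_total s s' with h | h
      · rw [max_eq_right h] at hc; linarith
      · rw [max_eq_left h] at hc; linarith
    · linarith [hs'.2]

set_option maxHeartbeats 3200000 in
/-- **Local joint-Hölder representatives around pairs of nearby points, constants first.** For
`0 < r₁ < R`, `M`, `P` there are `K`, `κ > 0` and a size `ϱ > 0` such that for every bounded
distributional Navier–Stokes solution on `Q(0, R)` (`|u| ≤ M` a.e., `∫∫ |p|^{3/2} ≤ P`) and all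
`w, w' ∈ Q(0, r₁)` with `|w.1 - w'.1| < ϱ²`, `|w.2 - w'.2| < ϱ/2` there is an open
`O ⊆ Q(0, R)` containing both and `W` with `HolderOnWith K κ W O`, `u = W` a.e. on `O`
(`SliceTimeHolderQuant.exists_holderOnWith_representative_quant` on the centred piece of
`exists_piece`, its Hölder-slice hypothesis supplied by `ae_smooth_slices`).
[cite: RobinsonRodrigoSadowskiCUP2016, Thm. 13.7 with Prop. 13.10] -/
theorem exists_local_holder_pairs {R r₁ : ℝ} (hr₁ : 0 < r₁) (hr₁R : r₁ < R) (M : ℝ) (P : ℝ≥0) :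
    ∃ (K κ : ℝ≥0) (ϱ : ℝ), 0 < κ ∧ 0 < ϱ ∧
      ∀ (u : ℝ → EuclideanSpace ℝ (Fin 3) → EuclideanSpace ℝ (Fin 3)) (p : ℝ → EuclideanSpace ℝ (Fin 3) → ℝ),
      IsDistributionalNSSolutionOn (parabolicCylinderOpens R (0 : ℝ × EuclideanSpace ℝ (Fin 3))) 1 0 u p →
      (∀ᵐ w ∂(volume.restrict (parabolicCylinder R (0 : ℝ × EuclideanSpace ℝ (Fin 3)))), ‖u w.1 w.2‖ ≤ M) →
      (∫⁻ w in parabolicCylinder R (0 : ℝ × EuclideanSpace ℝ (Fin 3)), ‖p w.1 w.2‖ₑ ^ (3 / 2 : ℝ) ≤ P) →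
      ∀ w ∈ cyl (r₁ ^ 2) r₁, ∀ w' ∈ cyl (r₁ ^ 2) r₁, |w.1 - w'.1| < ϱ ^ 2 → dist w.2 w'.2 < ϱ / 2 →
        ∃ (O : Set (ℝ × EuclideanSpace ℝ (Fin 3))) (W : ℝ × EuclideanSpace ℝ (Fin 3) → EuclideanSpace ℝ (Fin 3)),
          IsOpen O ∧ O ⊆ cyl (R ^ 2) R ∧ w ∈ O ∧ w' ∈ O ∧ HolderOnWith K κ W O ∧
          uncurry u =ᵐ[volume.restrict O] W := by
  have hR : 0 < R := hr₁.trans hr₁R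
  -- radii
  set ρ₁ : ℝ := (r₁ + R) / 2 with hρ₁
  set r₀ : ℝ := (ρ₁ + R) / 2 with hr₀
  set ρ₁' : ℝ := (r₁ + ρ₁) / 2 with hρ₁'
  set ϱ : ℝ := (ρ₁ - r₁) / 2 with hϱ
  have hr₁ρ₁ : r₁ < ρ₁ := by rw [hρ₁]; linarith
  have hρ₁R : ρ₁ < R := by rw [hρ₁]; linarith
  have hρ₁0 : 0 < ρ₁ := hr₁.trans hr₁ρ₁
  have hρ₁r₀ : ρ₁ < r₀ := by rw [hr₀]; linarith
  have hr₀R : r₀ < R := by rw [hr₀]; linarith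
  have hr₀0 : 0 < r₀ := hρ₁0.trans hρ₁r₀
  have hρ₁'1 : r₁ < ρ₁' := by rw [hρ₁']; linarith
  have hρ₁'2 : ρ₁' < ρ₁ := by rw [hρ₁']; linarith
  have hϱ0 : 0 < ϱ := by rw [hϱ]; linarith
  have hϱ1 : ϱ = ρ₁' - r₁ := by rw [hϱ, hρ₁']; ring
  have h2ϱ : 2 * ϱ ^ 2 ≤ ρ₁ ^ 2 - r₁ ^ 2 := by
    rw [hϱ]; nlinarith
  -- the constants
  obtain ⟨Ks, hKs⟩ := ae_smooth_slices (R := R) (r₀ := r₀) (L' := ρ₁ ^ 2) (ρ' := ρ₁) (r' := ρ₁') hr₀0 hr₀R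
    (by positivity) (by nlinarith) hρ₁0 hρ₁r₀ hρ₁'2 M P
  obtain ⟨Kq, κ, hκ, hquant⟩ := exists_holderOnWith_representative_quant (R := ϱ) (r := ϱ / 2)
    (half_pos hϱ0) (half_lt_self hϱ0) M P (3 * (3 * Ks 1)) 1 one_pos
  refine ⟨Kq, κ, ϱ, hκ, hϱ0, ?_⟩
  intro u p hsol hbd hP w hw w' hw' hclose1 hclose2
  rw [parabolicCylinder_zero_eq] at hbd hP
  obtain ⟨hws, hwy⟩ := mem_prod.1 hw
  obtain ⟨hw's, hw'y⟩ := mem_prod.1 hw'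
  rw [mem_ball, dist_zero_right] at hwy hw'y
  -- the piece
  obtain ⟨τ, hτ0, hτ1, hsI, hs'I⟩ := exists_piece hϱ0 h2ϱ hws hw's hclose1
  set z' : ℝ × EuclideanSpace ℝ (Fin 3) := (τ, w.2) with hz'
  set I' : Set ℝ := Ioo (τ - ϱ ^ 2) (τ + ϱ ^ 2) with hI'
  have hIsub : I' ⊆ Ioo (-ρ₁ ^ 2) 0 := Ioo_subset_Ioo hτ1 hτ0
  have hIsubR : I' ⊆ Ioo (-R ^ 2) 0 := hIsub.trans (Ioo_subset_Ioo (by nlinarith) le_rfl)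
  have hBsub : ball w.2 ϱ ⊆ ball (0 : EuclideanSpace ℝ (Fin 3)) ρ₁' := by
    intro x hx
    rw [mem_ball, dist_zero_right]
    rw [mem_ball] at hx
    calc ‖x‖ ≤ dist x w.2 + ‖w.2‖ := by
          have := norm_le_norm_add_norm_sub' x w.2
          rw [dist_eq_norm]; linarith [norm_sub_rev x w.2, norm_add_le (x - w.2) w.2, show x = (x - w.2) + w.2 by abel]
      _ < ϱ + r₁ := add_lt_add hx hwy
      _ = ρ₁' := by rw [hϱ1]; ring
  have hBsubR : ball w.2 ϱ ⊆ ball (0 : EuclideanSpace ℝ (Fin 3)) R :=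
    hBsub.trans (ball_subset_ball (by linarith))
  have hPsub : parabolicCylinderCentered ϱ z' ⊆ cyl (R ^ 2) R := by
    rw [parabolicCylinderCentered]
    exact Set.prod_mono hIsubR hBsubR
  -- the hypotheses of the quantitative representative theorem on the piece
  have hsol' : IsDistributionalNSSolutionOn (parabolicCylinderCenteredOpens ϱ z') 1 0 u p := by
    rw [parabolicCylinderOpens_zero_eq] at hsol
    exact IsDistributionalNSSolutionOn.mono_holds hsol (fun q hq => hPsub hq)
  have hbd' : ∀ᵐ q ∂(volume.restrict (parabolicCylinderCentered ϱ z')), ‖u q.1 q.2‖ ≤ M :=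
    ae_restrict_of_ae_restrict_of_subset hPsub hbd
  have hP' : ∫⁻ q in parabolicCylinderCentered ϱ z', ‖p q.1 q.2‖ₑ ^ (3 / 2 : ℝ) ≤ P :=
    (lintegral_mono_set hPsub).trans hP
  have hH : ∀ᵐ t ∂(volume.restrict (Ioo (z'.1 - ϱ ^ 2) (z'.1 + ϱ ^ 2))),
      ∃ v : EuclideanSpace ℝ (Fin 3) → EuclideanSpace ℝ (Fin 3),
        HolderOnWith (3 * (3 * Ks 1)) 1 v (ball z'.2 ϱ) ∧ u t =ᵐ[volume.restrict (ball z'.2 ϱ)] v := by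
    have hall : ∀ᵐ t ∂(volume.restrict (Ioo (-ρ₁ ^ 2) 0)), ∀ b : Fin 3, ∃ v : EuclideanSpace ℝ (Fin 3) → ℝ,
        (fun x => u t x b) =ᵐ[volume.restrict (ball (0 : EuclideanSpace ℝ (Fin 3)) ρ₁')] v ∧
        ContDiffOn ℝ ∞ v (ball (0 : EuclideanSpace ℝ (Fin 3)) ρ₁') ∧
        (∀ k : ℕ, ∀ x ∈ ball (0 : EuclideanSpace ℝ (Fin 3)) ρ₁', ‖iteratedFDeriv ℝ k v x‖ ≤ 3 ^ k * Ks k) ∧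
        ∀ x ∈ ball (0 : EuclideanSpace ℝ (Fin 3)) ρ₁', ∀ y ∈ ball (0 : EuclideanSpace ℝ (Fin 3)) ρ₁',
          ‖v x - v y‖ ≤ 3 * Ks 1 * ‖x - y‖ :=
      ae_all_iff.2 fun b => hKs u p hsol (by rwa [parabolicCylinder_zero_eq]) (by rwa [parabolicCylinder_zero_eq]) b
    have hall' := ae_restrict_of_ae_restrict_of_subset hIsub hall
    filter_upwards [hall'] with t ht
    choose vb _ _ _ hlip using ht
    refine ⟨fun x => WithLp.toLp 2 fun b => vb b x, ?_, ?_⟩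
    · refine holderOnWith_of_norm_sub_le fun x hx y hy => ?_
      rw [NNReal.coe_one, Real.rpow_one, dist_eq_norm]
      push_cast
      exact norm_toLp_sub_toLp_le hlip (hBsub hx) (hBsub hy)
    · have hcomp : ∀ b, ∀ᵐ x ∂(volume.restrict (ball (0 : EuclideanSpace ℝ (Fin 3)) ρ₁')), u t x b = vb b x := by
        intro b
        have h := (‹∀ b : Fin 3, (fun x => u t x b) =ᵐ[volume.restrict (ball (0 : EuclideanSpace ℝ (Fin 3)) ρ₁')] vb b› b)
        exact h
      have hall3 : ∀ᵐ x ∂(volume.restrict (ball (0 : EuclideanSpace ℝ (Fin 3)) ρ₁')), ∀ b, u t x b = vb b x :=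
        ae_all_iff.2 hcomp
      refine ae_restrict_of_ae_restrict_of_subset hBsub ?_
      filter_upwards [hall3] with x hx
      have e : u t x = WithLp.toLp 2 (fun b => u t x b) := (WithLp.toLp_ofLp 2 (u t x)).symm
      rw [e]
      congr 1
      funext b
      exact hx b
  obtain ⟨W, hW, hWae⟩ := hquant u p z' hsol' hbd' hP' hH
  refine ⟨Ioo (z'.1 - ϱ ^ 2) (z'.1 + ϱ ^ 2) ×ˢ ball z'.2 (ϱ / 2), W, isOpen_Ioo.prod isOpen_ball, ?_, ?_, ?_, hW, hWae⟩
  · exact (Set.prod_mono Subset.rfl (ball_subset_ball (by linarith))).trans hPsub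
  · exact ⟨hsI, mem_ball_self (half_pos hϱ0)⟩
  · refine ⟨hs'I, ?_⟩
    rw [mem_ball, dist_comm]; exact hclose2


/-! ### The continuous representative -/

/-- Every point of `Q(0, R)` lies in some `Q(0, r₁)`, `0 < r₁ < R`. [folklore] -/
theorem exists_mem_cyl_of_mem_cyl {R : ℝ} {w : ℝ × EuclideanSpace ℝ (Fin 3)} (hw : w ∈ cyl (R ^ 2) R) :
    ∃ r₁ : ℝ, 0 < r₁ ∧ r₁ < R ∧ w ∈ cyl (r₁ ^ 2) r₁ := by
  obtain ⟨hs, hy⟩ := mem_prod.1 hw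
  rw [mem_ball, dist_zero_right] at hy
  have hR : 0 < R := (norm_nonneg _).trans_lt hy
  set a : ℝ := max ‖w.2‖ (Real.sqrt (-w.1)) with ha
  have ha0 : 0 ≤ a := le_max_of_le_left (norm_nonneg _)
  have haR : a < R := by
    refine max_lt hy ?_
    rw [Real.sqrt_lt' hR]
    linarith [hs.1]
  refine ⟨(a + R) / 2, by linarith, by linarith, ?_⟩
  refine mem_prod.2 ⟨⟨?_, hs.2⟩, ?_⟩
  · have h1 : Real.sqrt (-w.1) ≤ a := le_max_right _ _
    have h2 : -w.1 ≤ a ^ 2 := by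
      calc -w.1 = Real.sqrt (-w.1) ^ 2 := (Real.sq_sqrt (by linarith [hs.2])).symm
        _ ≤ a ^ 2 := pow_le_pow_left₀ (Real.sqrt_nonneg _) h1 2
    nlinarith
  · rw [mem_ball, dist_zero_right]
    have : ‖w.2‖ ≤ a := le_max_left _ _
    linarith

set_option maxHeartbeats 3200000 in
/-- **The continuous representative, constants first** (Seregin–Šverák 2009, §2 p. 8, `k = 0`;
Robinson–Rodrigo–Sadowski 2016, Thm. 13.7 / Prop. 13.10, quantitative). For `R > 0`, `M`, `P`
there are `K, κ : ℝ → ℝ≥0` with `κ r₁ > 0` for `0 < r₁ < R` such that every bounded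
distributional Navier–Stokes solution `(u, p)` on `Q(0, R)` with `|u| ≤ M` a.e. and
`∫∫ |p|^{3/2} ≤ P` has a representative `V`, continuous on `Q(0, R)`, equal to `u` a.e. there,
bounded by `|M|`, and `HolderOnWith (K r₁) (κ r₁) V (Q(0, r₁))` for all `0 < r₁ < R`.
[cite: SereginSverak2009, §2 p. 8] -/
theorem exists_continuous_rep {R : ℝ} (M : ℝ) (P : ℝ≥0) :
    ∃ K κ : ℝ → ℝ≥0, (∀ r₁ ∈ Ioo 0 R, 0 < κ r₁) ∧
      ∀ (u : ℝ → EuclideanSpace ℝ (Fin 3) → EuclideanSpace ℝ (Fin 3)) (p : ℝ → EuclideanSpace ℝ (Fin 3) → ℝ),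
      IsDistributionalNSSolutionOn (parabolicCylinderOpens R (0 : ℝ × EuclideanSpace ℝ (Fin 3))) 1 0 u p →
      (∀ᵐ w ∂(volume.restrict (parabolicCylinder R (0 : ℝ × EuclideanSpace ℝ (Fin 3)))), ‖u w.1 w.2‖ ≤ M) →
      (∫⁻ w in parabolicCylinder R (0 : ℝ × EuclideanSpace ℝ (Fin 3)), ‖p w.1 w.2‖ₑ ^ (3 / 2 : ℝ) ≤ P) →
      ∃ V : ℝ × EuclideanSpace ℝ (Fin 3) → EuclideanSpace ℝ (Fin 3),
        ContinuousOn V (cyl (R ^ 2) R) ∧ uncurry u =ᵐ[volume.restrict (cyl (R ^ 2) R)] V ∧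
        (∀ w ∈ cyl (R ^ 2) R, ‖V w‖ ≤ |M|) ∧
        ∀ r₁ ∈ Ioo 0 R, HolderOnWith (K r₁) (κ r₁) V (cyl (r₁ ^ 2) r₁) := by
  classical
  -- the constants, for each `r₁`
  have hcon : ∀ r₁ : ℝ, ∃ (Kq κ : ℝ≥0) (ϱ : ℝ), 0 < κ ∧ 0 < ϱ ∧ (r₁ ∈ Ioo 0 R →
      ∀ (u : ℝ → EuclideanSpace ℝ (Fin 3) → EuclideanSpace ℝ (Fin 3)) (p : ℝ → EuclideanSpace ℝ (Fin 3) → ℝ),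
      IsDistributionalNSSolutionOn (parabolicCylinderOpens R (0 : ℝ × EuclideanSpace ℝ (Fin 3))) 1 0 u p →
      (∀ᵐ w ∂(volume.restrict (parabolicCylinder R (0 : ℝ × EuclideanSpace ℝ (Fin 3)))), ‖u w.1 w.2‖ ≤ M) →
      (∫⁻ w in parabolicCylinder R (0 : ℝ × EuclideanSpace ℝ (Fin 3)), ‖p w.1 w.2‖ₑ ^ (3 / 2 : ℝ) ≤ P) →
      ∀ w ∈ cyl (r₁ ^ 2) r₁, ∀ w' ∈ cyl (r₁ ^ 2) r₁, |w.1 - w'.1| < ϱ ^ 2 → dist w.2 w'.2 < ϱ / 2 →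
        ∃ (O : Set (ℝ × EuclideanSpace ℝ (Fin 3))) (W : ℝ × EuclideanSpace ℝ (Fin 3) → EuclideanSpace ℝ (Fin 3)),
          IsOpen O ∧ O ⊆ cyl (R ^ 2) R ∧ w ∈ O ∧ w' ∈ O ∧ HolderOnWith Kq κ W O ∧
          uncurry u =ᵐ[volume.restrict O] W) := by
    intro r₁
    by_cases h : r₁ ∈ Ioo 0 R
    · obtain ⟨Kq, κ, ϱ, hκ, hϱ, hh⟩ := exists_local_holder_pairs h.1 h.2 M P
      exact ⟨Kq, κ, ϱ, hκ, hϱ, fun _ => hh⟩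
    · exact ⟨1, 1, 1, one_pos, one_pos, fun h' => absurd h' h⟩
  choose Kq κ ϱ hκ hϱ hpairs using hcon
  -- the Hölder constant on `Q(0, r₁)`: local pairs, or the sup bound
  set η : ℝ → ℝ := fun r₁ => min (ϱ r₁ ^ 2) (ϱ r₁ / 2) with hη
  have hη0 : ∀ r₁, 0 < η r₁ := fun r₁ => lt_min (pow_pos (hϱ r₁) 2) (half_pos (hϱ r₁))
  set Kt : ℝ → ℝ≥0 := fun r₁ => Kq r₁ + (2 * |M| / η r₁ ^ (κ r₁ : ℝ)).toNNReal with hKt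
  refine ⟨Kt, κ, fun r₁ _ => hκ r₁, ?_⟩
  intro u p hsol hbd hP
  -- good pairs and the glued representative
  set good : Set (ℝ × EuclideanSpace ℝ (Fin 3)) → (ℝ × EuclideanSpace ℝ (Fin 3) → EuclideanSpace ℝ (Fin 3)) → Prop :=
    fun O W => IsOpen O ∧ O ⊆ cyl (R ^ 2) R ∧ ContinuousOn W O ∧ uncurry u =ᵐ[volume.restrict O] W with hgood
  set V : ℝ × EuclideanSpace ℝ (Fin 3) → EuclideanSpace ℝ (Fin 3) := fun w =>
    if h : ∃ O W, good O W ∧ w ∈ O then h.choose_spec.choose w else u w.1 w.2 with hV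
  -- `V` agrees with every good local representative on its domain
  have hVeq : ∀ O W, good O W → ∀ w ∈ O, V w = W w := by
    intro O W hOW w hw
    have hex : ∃ O W, good O W ∧ w ∈ O := ⟨O, W, hOW, hw⟩
    have hV' : V w = hex.choose_spec.choose w := by simp only [hV, dif_pos hex]
    rw [hV']
    set O' := hex.choose with hO'
    have hspec := hex.choose_spec.choose_spec
    set W' := hex.choose_spec.choose with hW'
    obtain ⟨⟨hO'open, -, hW'c, hW'ae⟩, hwO'⟩ := hspec
    obtain ⟨hOopen, -, hWc, hWae⟩ := hOW
    -- both are continuous on `O ∩ O'` and a.e. equal to `u` there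
    have hI : IsOpen (O ∩ O') := hOopen.inter hO'open
    have hae : W' =ᵐ[volume.restrict (O ∩ O')] W := by
      have h1 : uncurry u =ᵐ[volume.restrict (O ∩ O')] W' :=
        ae_restrict_of_ae_restrict_of_subset inter_subset_right hW'ae
      have h2 : uncurry u =ᵐ[volume.restrict (O ∩ O')] W :=
        ae_restrict_of_ae_restrict_of_subset inter_subset_left hWae
      exact h1.symm.trans h2
    exact eqOn_of_ae_eq_of_continuousOn (μ := volume) hI (hW'c.mono inter_subset_right) (hWc.mono inter_subset_left) hae
      ⟨hw, hwO'⟩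
  -- every point of `Q(0, R)` lies in a good pair with a Hölder representative
  have hlocal : ∀ w ∈ cyl (R ^ 2) R, ∃ O W, good O W ∧ w ∈ O := by
    intro w hw
    obtain ⟨r₁, hr₁0, hr₁R, hw₁⟩ := exists_mem_cyl_of_mem_cyl hw
    obtain ⟨O, W, hO, hOsub, hwO, -, hW, hWae⟩ := hpairs r₁ ⟨hr₁0, hr₁R⟩ u p hsol hbd hP w hw₁ w hw₁
      (by simp only [sub_self, abs_zero]; exact pow_pos (hϱ r₁) 2) (by rw [dist_self]; exact half_pos (hϱ r₁))
    exact ⟨O, W, ⟨hO, hOsub, hW.continuousOn (hκ r₁), hWae⟩, hwO⟩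
  -- continuity
  have hVc : ContinuousOn V (cyl (R ^ 2) R) := by
    intro w hw
    obtain ⟨O, W, hOW, hwO⟩ := hlocal w hw
    have hWc : ContinuousOn W O := hOW.2.2.1
    have hOo : IsOpen O := hOW.1
    have h1 : ContinuousAt W w := (hWc w hwO).continuousAt (hOo.mem_nhds hwO)
    have h2 : V =ᶠ[𝓝 w] W := by
      filter_upwards [hOo.mem_nhds hwO] with z hz
      exact hVeq O W hOW z hz
    exact (h1.congr_of_eventuallyEq h2).continuousWithinAt
  -- a.e. equality, through a countable subcover by good pairs
  have hae : uncurry u =ᵐ[volume.restrict (cyl (R ^ 2) R)] V := by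
    set piece : ℝ × EuclideanSpace ℝ (Fin 3) → Set (ℝ × EuclideanSpace ℝ (Fin 3)) := fun x =>
      if h : x ∈ cyl (R ^ 2) R then (hlocal x h).choose else univ with hpiece
    have hpiece_spec : ∀ x (h : x ∈ cyl (R ^ 2) R), ∃ W, good (piece x) W ∧ x ∈ piece x := by
      intro x h
      simp only [hpiece, dif_pos h]
      exact (hlocal x h).choose_spec
    have hnhds : ∀ x ∈ cyl (R ^ 2) R, piece x ∈ 𝓝[cyl (R ^ 2) R] x := by
      intro x hx
      obtain ⟨W, hg, hxp⟩ := hpiece_spec x hx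
      exact mem_nhdsWithin_of_mem_nhds (hg.1.mem_nhds hxp)
    obtain ⟨T, hTsub, hTc, hTcov⟩ := countable_cover_nhdsWithin hnhds
    -- on each piece `u = V` a.e.
    have hnull : ∀ x ∈ T, volume {z | z ∈ piece x ∧ uncurry u z ≠ V z} = 0 := by
      intro x hx
      obtain ⟨W, hg, -⟩ := hpiece_spec x (hTsub hx)
      have h1 : ∀ᵐ z ∂(volume : Measure (ℝ × EuclideanSpace ℝ (Fin 3))), z ∈ piece x → uncurry u z = W z :=
        (ae_restrict_iff' hg.1.measurableSet).1 hg.2.2.2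
      have h2 := ae_iff.1 h1
      refine measure_mono_null (fun z hz => ?_) h2
      intro himp
      exact hz.2 ((himp hz.1).trans (hVeq _ W hg z hz.1).symm)
    rw [EventuallyEq, ae_restrict_iff' (measurableSet_cyl _ _), ae_iff]
    refine measure_mono_null (fun z hz => ?_) ((measure_biUnion_null_iff hTc).2 hnull)
    have hz' : z ∈ cyl (R ^ 2) R ∧ uncurry u z ≠ V z := by
      by_contra h'
      exact hz fun hzc => by_contra fun hne => h' ⟨hzc, hne⟩
    obtain ⟨x, hxT, hzx⟩ := mem_iUnion₂.1 (hTcov hz'.1)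
    exact mem_iUnion₂.2 ⟨x, hxT, hzx, hz'.2⟩
  -- the sup bound
  have hsup : ∀ w ∈ cyl (R ^ 2) R, ‖V w‖ ≤ |M| := by
    refine norm_le_of_ae_of_continuousOn (μ := volume) (isOpen_Ioo.prod isOpen_ball) hVc ?_
    rw [parabolicCylinder_zero_eq] at hbd
    filter_upwards [hbd, hae] with z hz hz'
    rw [← hz']
    exact hz.trans (le_abs_self M)
  refine ⟨V, hVc, hae, hsup, fun r₁ hr₁ => ?_⟩
  -- Hölder continuity on `Q(0, r₁)`
  have hsub₁ : cyl (r₁ ^ 2) r₁ ⊆ cyl (R ^ 2) R := cyl_mono (by nlinarith [hr₁.1, hr₁.2]) hr₁.2.le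
  refine holderOnWith_of_norm_sub_le fun w hw w' hw' => ?_
  have hKq : (Kq r₁ : ℝ) ≤ Kt r₁ := by
    simp only [hKt, NNReal.coe_add]; linarith [((2 * |M| / η r₁ ^ (κ r₁ : ℝ)).toNNReal).coe_nonneg]
  have hdn : 0 ≤ dist w w' := dist_nonneg
  by_cases hclose : |w.1 - w'.1| < ϱ r₁ ^ 2 ∧ dist w.2 w'.2 < ϱ r₁ / 2
  · obtain ⟨O, W, hO, hOsub, hwO, hw'O, hW, hWae⟩ := hpairs r₁ hr₁ u p hsol hbd hP w hw w' hw' hclose.1 hclose.2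
    have hg : good O W := ⟨hO, hOsub, hW.continuousOn (hκ r₁), hWae⟩
    have e1 : V w = W w := hVeq O W hg w hwO
    have e2 : V w' = W w' := hVeq O W hg w' hw'O
    calc ‖V w - V w'‖ = dist (W w) (W w') := by rw [e1, e2, dist_eq_norm]
      _ ≤ Kq r₁ * dist w w' ^ (κ r₁ : ℝ) := hW.dist_le hwO hw'O
      _ ≤ Kt r₁ * dist w w' ^ (κ r₁ : ℝ) := mul_le_mul_of_nonneg_right hKq (Real.rpow_nonneg hdn _)
  · -- far apart: the sup bound
    have hfar : η r₁ ≤ dist w w' := by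
      rw [not_and_or, not_lt, not_lt] at hclose
      rw [Prod.dist_eq]
      rcases hclose with h | h
      · refine (min_le_left _ _).trans (h.trans ?_)
        rw [Real.dist_eq]; exact le_max_left _ _
      · exact (min_le_right _ _).trans (h.trans (le_max_right _ _))
    have hηκ : 0 < η r₁ ^ (κ r₁ : ℝ) := Real.rpow_pos_of_pos (hη0 r₁) _
    calc ‖V w - V w'‖ ≤ ‖V w‖ + ‖V w'‖ := norm_sub_le _ _
      _ ≤ |M| + |M| := add_le_add (hsup w (hsub₁ hw)) (hsup w' (hsub₁ hw'))
      _ = (2 * |M| / η r₁ ^ (κ r₁ : ℝ)) * η r₁ ^ (κ r₁ : ℝ) := by field_simp; ring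
      _ ≤ (2 * |M| / η r₁ ^ (κ r₁ : ℝ)) * dist w w' ^ (κ r₁ : ℝ) := by
          refine mul_le_mul_of_nonneg_left (Real.rpow_le_rpow (hη0 r₁).le hfar (κ r₁).coe_nonneg) (by positivity)
      _ ≤ Kt r₁ * dist w w' ^ (κ r₁ : ℝ) := by
          refine mul_le_mul_of_nonneg_right ?_ (Real.rpow_nonneg hdn _)
          simp only [hKt, NNReal.coe_add]
          rw [Real.coe_toNNReal _ (by positivity)]
          linarith [(Kq r₁).coe_nonneg]

end NSBootstrap

end Literature.Analysis.FluidPDE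

end
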